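import Summits.Ventures.PercRepro.RankLevelSetCoreGeneral
import Summits.Ventures.PercRepro.RankLevelSetCoreFour

/-!
# PercRepro — THE CORANK-`≥ 28` CORE THEOREM AT LEVEL `5` FROM RANK `29` (p7, gen 0; sub-claim S2, R3)

`proofs/SUBCLAIM-S2-p7.md` R3. night-1's `c025_core_five_twentyone` (RankLevelSetCoreFour) closes the `e`-free core
at level `5` at every corank `≥ 28` for `p ≥ 50`, the `50` being `max (max N₁ P₂) (2^5 + 2)`: `N₁ = 50` is the
regime-I threshold on `n = |E|` (but `n ≥ p + 28 ≥ 50` once `p ≥ 22`), `P₂ = 40` the crude regime-II criterion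
`2^{p+q}·2^{B−q}·(2a + 1) ≤ 4^a`, and `2^5 + 2 = 34` the local-sparsity form of `#Y ≥ C(n, p − 1)`. Here:

* **`choose_le_midCount_of_bound`** — `#Y(p, q) ≥ C(n, p − 1)` from the flat bound `f(q) ≤ B` once `B + 2 ≤ p`;
* **`choose_ratio_mono_succ`**, **`regimeII_key_of_base`** — `C(n, p − 1) / C(n, q)` is non-decreasing in `n`, so the
  regime-II key inequality `2^{p+q}·K·C(n, q) ≤ C(p+q, p)·C(n, p − 1)` for all `n ≥ n₀` follows from its instance at
  `n = n₀` — at `n₀ = 2p` a numeral, decided by the kernel for `29 ≤ p ≤ 39` (`key_two_mul_of_le_39`);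
* **`core_all_corank_of_bound_key`** — night-1's core theorem with regime I's threshold on `n`, regime II's key as a
  hypothesis and the flat-bound form of `#Y ≥ C(n, p − 1)` (the proof is night-1's line for line otherwise);
* **`c025_core_five_twentyone_twentynine`** — the `e`-free core at level `5`, every corank `≥ 28`, every `p ≥ 29`
  (`p ≥ 40` by the crude criterion, `29 ≤ p ≤ 39` by the decided instances).
Cells of the S2 map this closes: `(p, d)` with `29 ≤ p ≤ 49`, `d ≥ 28` (open in v2). Still open at corank `≥ 28`:
`p ≤ 28` (the key fails at `n = 2p` for `p ≤ 28`; with `#Y ≥ Σ_{B < s < p} C(n, s)` it would hold from `p = 27`).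
Axioms: standard.
-/

open scoped Matroid

namespace PercRepro

namespace ThmN

open Set

variable {α : Type}

/-- **`C(n, p − 1) ≤ #Y(p, q)` from the flat bound**: every `(p − 1)`-subset of `E` has rank `< p`, and rank `> q`
since a set of rank `≤ q` has `≤ B < p − 1` points. -/
theorem choose_le_midCount_of_bound (M : Matroid α) [M.Finite]
    (hfree : ∀ e ∈ M.E, ∃ A ⊆ M.E \ {e}, e ∉ M.closure A ∧ e ∉ M.closure ((M.E \ {e}) \ A))
    {p q B : ℕ} (hBq : ∀ X ⊆ M.E, M.eRk X ≤ q → X.ncard ≤ B) (hp : B + 2 ≤ p) :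
    M.ground_finite.toFinset.card.choose (p - 1) ≤ Matroid.midCount M p q := by
  have _hL := not_isLoop_of_free M hfree
  have hE : (M.ground_finite.toFinset : Set α) = M.E := Set.Finite.coe_toFinset _
  rw [← ncard_subsets_ncard_eq M.ground_finite.toFinset (p - 1)]
  unfold Matroid.midCount
  apply Set.ncard_le_ncard
  · intro X hX
    have hXE : X ⊆ M.E := by rw [← hE]; exact hX.1
    have hXfin : X.Finite := M.ground_finite.subset hXE
    refine ⟨hXE, ?_, ?_⟩
    · by_contra hle
      push Not at hle
      have := hBq X hXE hle
      have hc := hX.2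
      omega
    · calc M.eRk X ≤ X.encard := M.eRk_le_encard X
        _ = ((p - 1 : ℕ) : ℕ∞) := by rw [← hXfin.cast_ncard_eq, hX.2]
        _ < (p : ℕ∞) := by exact_mod_cast (show p - 1 < p by omega)
  · exact M.ground_finite.finite_subsets.subset (fun X hX => hX.1)

/-- **`C(n, p − 1) / C(n, q)` is non-decreasing in `n`** (`q + 1 ≤ p ≤ n + 1`), in cross-multiplied form. -/
theorem choose_ratio_mono_succ (n p q : ℕ) (hq : q + 1 ≤ p) (hn : p ≤ n + 1) :
    n.choose (p - 1) * (n + 1).choose q ≤ (n + 1).choose (p - 1) * n.choose q := by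
  have h1 := Nat.choose_mul_succ_eq n (p - 1)
  have h2 := Nat.choose_mul_succ_eq n q
  have hle : n + 1 - (p - 1) ≤ n + 1 - q := by omega
  have hpos : 0 < (n + 1 - (p - 1)) * (n + 1 - q) := Nat.mul_pos (by omega) (by omega)
  refine Nat.le_of_mul_le_mul_right ?_ hpos
  calc n.choose (p - 1) * (n + 1).choose q * ((n + 1 - (p - 1)) * (n + 1 - q))
      = (n.choose (p - 1) * (n + 1 - (p - 1))) * ((n + 1).choose q * (n + 1 - q)) := by ring
    _ = (n.choose (p - 1) * (n + 1 - (p - 1))) * (n.choose q * (n + 1)) := by rw [h2]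
    _ ≤ (n.choose (p - 1) * (n + 1 - q)) * (n.choose q * (n + 1)) := by gcongr
    _ = (n.choose (p - 1) * (n + 1)) * (n.choose q * (n + 1 - q)) := by ring
    _ = ((n + 1).choose (p - 1) * (n + 1 - (p - 1))) * (n.choose q * (n + 1 - q)) := by rw [h1]
    _ = (n + 1).choose (p - 1) * n.choose q * ((n + 1 - (p - 1)) * (n + 1 - q)) := by ring

/-- **The regime-II key from one instance**: `2^{p+q}·K·C(n, q) ≤ C·C(n, p − 1)` at `n = n₀` propagates to every
`n ≥ n₀` (`q + 1 ≤ p ≤ n₀ + 1`, `q ≤ n₀`). -/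
theorem regimeII_key_of_base (p q K C n₀ : ℕ) (hq : q + 1 ≤ p) (hn₀ : p ≤ n₀ + 1) (hqn : q ≤ n₀)
    (hbase : 2 ^ (p + q) * K * n₀.choose q ≤ C * n₀.choose (p - 1)) :
    ∀ n, n₀ ≤ n → 2 ^ (p + q) * K * n.choose q ≤ C * n.choose (p - 1) := by
  intro n hn
  induction n, hn using Nat.le_induction with
  | base => exact hbase
  | succ n hn ih =>
    have hmono := choose_ratio_mono_succ n p q hq (by omega)
    have hpos : 0 < n.choose q := Nat.choose_pos (by omega)
    refine Nat.le_of_mul_le_mul_right ?_ hpos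
    calc 2 ^ (p + q) * K * (n + 1).choose q * n.choose q
        = (2 ^ (p + q) * K * n.choose q) * (n + 1).choose q := by ring
      _ ≤ (C * n.choose (p - 1)) * (n + 1).choose q := Nat.mul_le_mul_right _ ih
      _ = C * (n.choose (p - 1) * (n + 1).choose q) := by ring
      _ ≤ C * ((n + 1).choose (p - 1) * n.choose q) := Nat.mul_le_mul_left _ hmono
      _ = C * (n + 1).choose (p - 1) * n.choose q := by ring

/-- The regime-II key at `q = 5`, `B = 21`, `n = 2p`, for `29 ≤ p ≤ 39` — eleven numerals, decided. -/
theorem key_two_mul_of_le_39 (p : ℕ) (hp : 29 ≤ p) (hp' : p ≤ 39) :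
    2 ^ (p + 5) * 2 ^ (21 - 5) * (2 * p).choose 5 ≤ (p + 5).choose p * (2 * p).choose (p - 1) := by
  interval_cases p <;> decide

/-- **THEOREM C∞, THE CORE, WITH AN ARBITRARY FLAT BOUND AND THE REGIME-II KEY AS A HYPOTHESIS**: night-1's proof
once more, with regime II (`n ≥ 2p`) fed the inequality `2^{p+q}·2^{B−q}·C(n, q) ≤ C(p+q, p)·C(n, p − 1)` directly
(`hkey`) instead of through the crude criterion `P₂`, and `#Y ≥ C(n, p − 1)` from the flat bound (`B + 2 ≤ p`)
instead of local sparsity. -/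
theorem core_all_corank_of_bound_key (q B : ℕ) (hq : 2 ≤ q) (hqB : q ≤ B) (N₁ : ℕ)
    (hN₁ : ∀ n, N₁ ≤ n → 8 * (q + 1) * 2 ^ (B - q) * n ^ q ≤ 2 ^ n) :
    ∀ {α : Type} (M : Matroid α) [M.Finite] (p : ℕ), B + 2 ≤ p → N₁ ≤ p + q + B + 2 →
      (∀ n, 2 * p ≤ n → 2 ^ (p + q) * 2 ^ (B - q) * n.choose q ≤ (p + q).choose p * n.choose (p - 1)) →
      M.eRank = (p : ℕ∞) → p + q + B + 1 < M.E.ncard →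
      (∀ e ∈ M.E, ∃ A ⊆ M.E \ {e}, e ∉ M.closure A ∧ e ∉ M.closure ((M.E \ {e}) \ A)) →
      (∀ j, j ≤ q → ∀ X ⊆ M.E, M.eRk X ≤ j → X.ncard + q ≤ B + j) → RLS M p q := by
  classical
  intro α M _ p hpB hN₁B hkey hR hbig hfree hBj
  set n := M.E.ncard with hn_def
  have hEcard : M.ground_finite.toFinset.card = n := by
    rw [hn_def, Set.ncard_eq_toFinset_card _ M.ground_finite]
  have hq2 : 2 * q ≤ 2 ^ q := by
    have : q ≤ 2 ^ (q - 1) := by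
      calc q = (q - 1) + 1 := by omega
        _ ≤ 2 ^ (q - 1) := Nat.lt_two_pow_self
    calc 2 * q ≤ 2 * 2 ^ (q - 1) := by omega
      _ = 2 ^ (q - 1 + 1) := by ring
      _ = 2 ^ q := by congr 1; omega
  have hN₁p : N₁ ≤ n := by omega
  have hpn : p ≤ n := by omega
  have hBq' : ∀ X ⊆ M.E, M.eRk X ≤ q → X.ncard ≤ B := fun X hX hr => by
    have := hBj q le_rfl X hX hr; omega
  have hU : Matroid.topCount M p q ≤ n.choose q * 2 ^ (B - q) := by
    calc Matroid.topCount M p q ≤ Matroid.levelCount M q := Matroid.topCount_le_levelCount_bot p q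
      _ = {X : Set α | X ⊆ M.E ∧ M.eRk X = q}.ncard := rfl
      _ ≤ n.choose q * 2 ^ (B - q) := by rw [← hEcard]; exact ncard_eRk_eq_le_choose_mul_of_bound M q B hBq'
  have hΦ := phiK_le_two_pow_div p q
  have hU0 : (0 : ℚ) ≤ (Matroid.topCount M p q : ℚ) := by positivity
  have hUq : (Matroid.topCount M p q : ℚ) ≤ (n.choose q : ℚ) * 2 ^ (B - q) := by exact_mod_cast hU
  rw [RLS_iff]
  rcases Nat.lt_or_ge n (2 * p) with hsmall | hlarge
  · have hd : M.E.encard = M.eRank + ((n - p : ℕ) : ℕ∞) := by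
      rw [hR, ← M.ground_finite.cast_ncard_eq]
      norm_cast
      omega
    have hY := Matroid.two_pow_le_midCount_add (M := M) p q hR
    have hA := ncard_eRk_le_le_sum_choose_mul_of_bound M q B hBj
    have hB := Matroid.ncard_spanning_le (M := M) hd
    rw [hEcard] at hY hA hB
    have hA' : (∑ j ∈ Finset.range (q + 1), n.choose j) * 2 ^ (B - q) ≤ 2 ^ (n - 3) := by
      have h1 := sum_choose_le_mul_pow n q (by omega)
      have h2 := hN₁ n (by omega)
      have h3 : 2 ^ n = 2 ^ (n - 3) * 8 := by
        rw [show (8 : ℕ) = 2 ^ 3 by norm_num, ← pow_add]; congr 1; omega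
      have h5 : 8 * ((∑ j ∈ Finset.range (q + 1), n.choose j) * 2 ^ (B - q)) ≤ 8 * 2 ^ (n - 3) := by
        calc 8 * ((∑ j ∈ Finset.range (q + 1), n.choose j) * 2 ^ (B - q))
            ≤ 8 * (((q + 1) * n ^ q) * 2 ^ (B - q)) := by gcongr
          _ = 8 * (q + 1) * 2 ^ (B - q) * n ^ q := by ring
          _ ≤ 2 ^ n := h2
          _ = 8 * 2 ^ (n - 3) := by rw [h3]; ring
      exact Nat.le_of_mul_le_mul_left h5 (by norm_num)
    have hB' : ∑ j ∈ Finset.range (n - p + 1), n.choose j ≤ 2 ^ (n - 1) :=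
      sum_choose_le_two_pow_pred n (n - p) (by omega)
    have hCn : n.choose q ≤ 2 ^ q * (p + q).choose p := by
      rw [Nat.choose_symm_add]
      exact choose_le_two_pow_mul_choose n p q (by omega)
    have hYq : (2 : ℚ) ^ n ≤ (Matroid.midCount M p q : ℚ) + ({X : Set α | X ⊆ M.E ∧ M.eRk X ≤ q}.ncard : ℚ) +
        ({X : Set α | X ⊆ M.E ∧ M.eRk X = M.eRank}.ncard : ℚ) := by exact_mod_cast hY
    have hAq : ({X : Set α | X ⊆ M.E ∧ M.eRk X ≤ q}.ncard : ℚ) ≤ 2 ^ (n - 3) := by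
      exact_mod_cast hA.trans hA'
    have hBq2 : ({X : Set α | X ⊆ M.E ∧ M.eRk X = M.eRank}.ncard : ℚ) ≤ 2 ^ (n - 1) := by
      exact_mod_cast hB.trans hB'
    have hCnq : (n.choose q : ℚ) ≤ 2 ^ q * ((p + q).choose p : ℚ) := by exact_mod_cast hCn
    have hk : p + 2 * q + (B - q) + 2 ≤ n := by omega
    exact coreSharper_arith_I hq hk hΦ hU0 hUq hCnq hYq hAq hBq2
  · have hY := choose_le_midCount_of_bound M hfree hBq' hpB
    rw [hEcard] at hY
    have hkey := hkey n hlarge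
    have hYq : (n.choose (p - 1) : ℚ) ≤ (Matroid.midCount M p q : ℚ) := by exact_mod_cast hY
    have hUq' : (Matroid.topCount M p q : ℚ) ≤ (n.choose q : ℚ) * ((2 ^ (B - q) : ℕ) : ℚ) := by
      exact_mod_cast hU
    exact coreSharp_arith_II hΦ hU0 hUq' hkey hYq


/-- **The `e`-free core at level `5`, every corank `≥ 28`, every rank `p ≥ 29`** (`p ≥ 40`: the crude regime-II
criterion of `c025_core_five_twentyone`; `29 ≤ p ≤ 39`: the decided instances at `n = 2p`). -/
theorem c025_core_five_twentyone_twentynine (M : Matroid α) [M.Finite] (p : ℕ) (hp : 29 ≤ p)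
    (hR : M.eRank = (p : ℕ∞)) (hbig : p + 27 < M.E.ncard)
    (hfree : ∀ e ∈ M.E, ∃ A ⊆ M.E \ {e}, e ∉ M.closure A ∧ e ∉ M.closure ((M.E \ {e}) \ A)) : RLS M p 5 := by
  have hN₁ : ∀ n, 50 ≤ n → 8 * (5 + 1) * 2 ^ (21 - 5) * n ^ 5 ≤ 2 ^ n :=
    mul_pow_le_two_pow_of_base (8 * (5 + 1) * 2 ^ (21 - 5)) 5 50 (by norm_num) (by norm_num) (by norm_num)
  have hBj : ∀ j : ℕ, j ≤ 5 → ∀ X ⊆ M.E, M.eRk X ≤ j → X.ncard + 5 ≤ 21 + j := by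
    intro j hj X hX hr
    rcases Nat.lt_or_ge j 4 with h | h
    · have := ncard_add_one_le_two_pow_of_eRk_le M (not_isLoop_of_free M hfree) hfree j X hX hr
      interval_cases j <;> omega
    · rcases Nat.lt_or_ge j 5 with h5 | h5
      · have hj4 : j = 4 := by omega
        subst hj4
        have := ncard_le_ten_of_eRk_le_four_of_free M hfree hX hr
        omega
      · have hj5 : j = 5 := by omega
        subst hj5
        have := ncard_le_twentyone_of_eRk_le_five_of_free M hfree hX hr
        omega
  have hkey : ∀ n, 2 * p ≤ n → 2 ^ (p + 5) * 2 ^ (21 - 5) * n.choose 5 ≤ (p + 5).choose p * n.choose (p - 1) := by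
    rcases Nat.lt_or_ge p 40 with h | h
    · exact regimeII_key_of_base p 5 (2 ^ (21 - 5)) ((p + 5).choose p) (2 * p) (by omega) (by omega) (by omega)
        (key_two_mul_of_le_39 p hp (by omega))
    · intro n hn
      have hP₂ := threshold_II_of_base 5 (2 ^ (21 - 5)) 40 (by norm_num) (by norm_num)
      exact choose_mul_le_choose_mul_of_threshold n p 5 (2 ^ (21 - 5)) (by omega) hn (hP₂ p h)
  exact core_all_corank_of_bound_key 5 21 (by norm_num) (by norm_num) 50 hN₁ M p (by omega) (by omega) hkey hR
    (by omega) hfree hBj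

end ThmN

end PercRepro
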